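import Literature.Topology.FourManifolds.SolidTorusHandlebody
import Literature.Topology.FourManifolds.RegularSublevelMaps
import Literature.Topology.FourManifolds.BoundaryOrientation
import Literature.Topology.FourManifolds.LickorishWallaceHandlebodies
import Mathlib.Analysis.InnerProductSpace.Projection.FiniteDimensional
import HarnessLib

/-!
# Mirror-symmetric handlebodies in `ℝ³`: SYMM from an even Morse function, and genus one

Topic `Literature/Topology/FourManifolds`; fact seat
`provefact-Literature.IsHandlebody.exists_diffeomorph_isOrientationReversing_boundary` (F2b₂ of
`LickorishWallaceSphereGluing.lean`: "every handlebody admits an orientation-reversing symmetry",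
Juhász, *Differential and Low-Dimensional Topology* (2023), §3.5, p. 97).
`LickorishWallaceHandlebodies.lean` reduced F2b₂ to the classification UNIQ
(`Literature.Topology.FourManifolds.IsHandlebody.nonempty_diffeomorph`) and the one-model fact **SYMM**
`Literature.Topology.FourManifolds.exists_isHandlebody_isOrientationReversing` ("for every `g` some genus-`g` handlebody has a
self-diffeomorphism restricting to an orientation-reversing diffeomorphism of its boundary"),
proved there for `g = 0`.  This file proves the **mechanism of SYMM in every genus** and
**SYMM for `g = 1`**:

* `Literature.Topology.FourManifolds.IsOrientationPreserving.of_comp_left` — cancellation: if `g ∘ f` and `g` preserve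
  orientations (all differentials invertible) then so does `f` (Hirsch (1976), Ch. 4 §4).
* `Literature.Topology.FourManifolds.reflectThirdCLE`, `Literature.Topology.FourManifolds.reflectThird` — the reflection `(x, y, z) ↦ (x, y, -z)` of `ℝ³`
  (Mathlib's `((ℝ ∙ e₂)ᗮ).reflection`) as a linear isometry / diffeomorphism, its coordinates
  (`reflectThirdCLE_apply_coord`), Jacobian determinant `-1` (`det_reflectThirdCLE`, Mathlib
  `Submodule.det_reflection`) and orientation character: it reverses the standard orientation of
  `ℝ³` at every point (`reflectThird_isOrientationReversing`; Hirsch, Ch. 4 §4, p. 105).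
* **The mechanism** (`RegularSublevel.mirror`, `boundaryMirror`, `mirror_incl`,
  `mirror_isOrientationReversing`, `boundaryMirror_isOrientationReversing`): for *any* smooth
  `F : ℝ³ → ℝ` invariant under `z ↦ -z` and any regular level `c`, the reflection induces a
  self-diffeomorphism `R₀` of the regular sublevel set `{F ≤ c}` (`RegularSublevel.mapDiffeomorph`,
  `RegularSublevelMaps.lean`) and `r₀` of its boundary `{F = c}` with `R₀ ∘ incl = incl ∘ r₀`;
  `R₀` reverses the orientation induced from `ℝ³` (`incl ∘ R₀ = R ∘ incl` with `incl`
  orientation preserving and `R` reversing: cancel `incl`), hence `r₀` reverses the boundary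
  orientation (`SmoothOrientation.boundary`, `Diffeomorph.isOrientationReversing_boundaryMap`,
  `BoundaryOrientation.lean`).  So **every genus-`g` handlebody of the form `{F ≤ c}` with `F`
  even in `z` witnesses SYMM at `g`** (`RegularSublevel.exists_isHandlebody_isOrientationReversing_of_even`),
  and a family of such models, one per genus, proves SYMM outright
  (`exists_isHandlebody_isOrientationReversing_of_even_models`, universe `0`).
* **Genus one** (`SolidTorusModel.fn_reflectThird`,
  `exists_isHandlebody_isOrientationReversing_one`): the solid torus
  `V₁ = {(x²+y²)² - 392(x²+y²) + z² - 3840x ≤ 10000}` of `SolidTorusHandlebody.lean`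
  (`Literature.Topology.FourManifolds.SolidTorusModel.isHandlebody_one_solidTorus`) is such a model, so SYMM holds at `g = 1`;
  with UNIQ this gives F2b₂ for `g ≤ 1`
  (`IsHandlebody.exists_diffeomorph_isOrientationReversing_boundary_of_le_one`, universe `0`).

Juhász's sentence is printed without proof; the argument formalised here is the standard one
(the mirror image of the standard handlebody `♮^g (S¹ × D²) ⊂ ℝ³` in a plane containing the
cores, which reverses the orientation of `ℝ³` and hence of the handlebody and of its boundary;
Hirsch (1976), Ch. 4 §4 for orientation characters of reflections and boundary orientations).

## References

* A. Juhász, *Differential and Low-Dimensional Topology*, LMS Student Texts 104 (2023), §3.5,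
  pp. 96–97. [Juhasz2023]
* M. W. Hirsch, *Differential Topology*, GTM 33 (1976), Ch. 4 §4, pp. 101–105. [HirschDT1976]
* J. Schultens, *Introduction to 3-Manifolds*, GSM 151 (2014), Def. 6.1.5, Example 6.1.9
  (the solid torus is the genus-one handlebody). [Schultens2014]
-/

open scoped Manifold ContDiff Topology InnerProductSpace
open Set Function Module

noncomputable section

namespace Literature.Topology.FourManifolds

universe u

/-- Local notation: `𝔼 n` is the model Euclidean space `EuclideanSpace ℝ (Fin n)`. -/
local notation "𝔼 " n:arg => EuclideanSpace ℝ (Fin n)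

/-! ### §1 Cancellation for orientation-preserving maps -/

section Cancel

variable {E H H' H'' : Type*} [NormedAddCommGroup E] [NormedSpace ℝ E] [TopologicalSpace H]
  [TopologicalSpace H'] [TopologicalSpace H''] {I : ModelWithCorners ℝ E H}
  {I' : ModelWithCorners ℝ E H'} {I'' : ModelWithCorners ℝ E H''}
  {M : Type*} [TopologicalSpace M] [ChartedSpace H M] [IsManifold I 1 M]
  {N : Type*} [TopologicalSpace N] [ChartedSpace H' N] [IsManifold I' 1 N]
  {P : Type*} [TopologicalSpace P] [ChartedSpace H'' P] [IsManifold I'' 1 P]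

/-- **Cancellation of an orientation-preserving local diffeomorphism on the left.** If `g ∘ f`
preserves the orientations `oM`, `oP` and `g` preserves `oN`, `oP`, all differentials being
invertible, then `f` preserves `oM`, `oN` (chain rule and the sign rule for `det`; Hirsch,
*Differential Topology* (1976), §4.4, p. 101). [folklore] -/
theorem IsOrientationPreserving.of_comp_left {oM : SmoothOrientation I M}
    {oN : SmoothOrientation I' N} {oP : SmoothOrientation I'' P} {g : N → P} {f : M → N}
    (hgf : IsOrientationPreserving oM oP (g ∘ f)) (hg : IsOrientationPreserving oN oP g)
    (hgd : MDifferentiable I' I'' g) (hfd : MDifferentiable I I' f)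
    (hg' : ∀ y, LinearMap.det (M := E) (mfderiv I' I'' g y).toLinearMap ≠ 0)
    (hf' : ∀ x, LinearMap.det (M := E) (mfderiv I I' f x).toLinearMap ≠ 0) :
    IsOrientationPreserving oM oN f := by
  intro x
  have hchain : mfderiv I I'' (g ∘ f) x = (mfderiv I' I'' g (f x)).comp (mfderiv I I' f x) :=
    mfderiv_comp x (hgd (f x)) (hfd x)
  set a := LinearMap.det (M := E) (mfderiv I' I'' g (f x)).toLinearMap with ha_def
  set b := LinearMap.det (M := E) (mfderiv I I' f x).toLinearMap with hb_def
  have hdet : LinearMap.det (M := E) (mfderiv I I'' (g ∘ f) x).toLinearMap = a * b := by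
    rw [hchain]
    exact LinearMap.det_comp (M := E) (mfderiv I' I'' g (f x)).toLinearMap
      (mfderiv I I' f x).toLinearMap
  have h1 : (oP (g (f x)) = oM x ↔ 0 < a * b) := hdet ▸ hgf x
  have h2 : (oP (g (f x)) = oN (f x) ↔ 0 < a) := hg (f x)
  have h3 := orientation_eq_iff_eq_iff_eq (oP (g (f x))) (oN (f x)) (oM x)
  have h4 := mul_pos_iff_pos_iff_pos (hg' (f x)) (hf' x)
  show (oN (f x) = oM x ↔ 0 < b)
  tauto

end Cancel

/-! ### §2 The reflection of `ℝ³` in the plane `{z = 0}` -/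

section Reflection

/-- The third standard basis vector `e₂ = (0, 0, 1)` of `ℝ³`. [folklore] -/
def e₂ : 𝔼 3 := EuclideanSpace.single (2 : Fin 3) (1 : ℝ)

/-- The coordinates of `e₂`. [folklore] -/
@[simp] theorem e₂_apply (i : Fin 3) : e₂ i = if i = 2 then 1 else 0 := by
  simp [e₂]

/-- `e₂ ≠ 0`. [folklore] -/
theorem e₂_ne_zero : e₂ ≠ 0 := by
  intro h
  have := congrArg (fun v : 𝔼 3 => v 2) h
  simp at this

/-- **The reflection of `ℝ³` in the coordinate plane `{z = 0}`**, `(x, y, z) ↦ (x, y, -z)`,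
as Mathlib's hyperplane reflection `((ℝ ∙ e₂)ᗮ).reflection` (a linear isometry). [folklore] -/
def reflectThirdCLE : 𝔼 3 ≃L[ℝ] 𝔼 3 := ((ℝ ∙ e₂)ᗮ).reflection.toContinuousLinearEquiv

/-- The reflection in coordinates: `R p = p - 2 p₂ e₂`. [folklore] -/
theorem reflectThirdCLE_apply (p : 𝔼 3) : reflectThirdCLE p = p - (2 * p 2) • e₂ := by
  show ((ℝ ∙ e₂)ᗮ).reflection p = _
  rw [Submodule.reflection_orthogonal_apply, Submodule.reflection_singleton_apply]
  have hn : ‖e₂‖ = 1 := by simp [e₂]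
  have hip : ⟪e₂, p⟫_ℝ = p 2 := by simp [e₂, EuclideanSpace.inner_single_left]
  rw [hn, hip]
  simp only [RCLike.ofReal_one, one_pow, div_one]
  module

/-- The coordinates of the reflected point: `(x, y, z) ↦ (x, y, -z)`. [folklore] -/
theorem reflectThirdCLE_apply_coord (p : 𝔼 3) (i : Fin 3) :
    reflectThirdCLE p i = if i = 2 then -p 2 else p i := by
  rw [reflectThirdCLE_apply]
  simp only [PiLp.sub_apply, PiLp.smul_apply, e₂_apply, smul_eq_mul]
  split_ifs with h
  · subst h; ring
  · ring

/-- The Jacobian determinant of the reflection is `-1` (Mathlib `Submodule.det_reflection`: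
`det = (-1) ^ finrank (ℝ ∙ e₂) = -1`). [folklore] -/
theorem det_reflectThirdCLE :
    LinearMap.det ((reflectThirdCLE : 𝔼 3 →L[ℝ] 𝔼 3) : 𝔼 3 →ₗ[ℝ] 𝔼 3) = -1 := by
  have h := Submodule.det_reflection (K := (ℝ ∙ e₂)ᗮ)
  rw [Submodule.orthogonal_orthogonal, finrank_span_singleton e₂_ne_zero, pow_one] at h
  exact h

/-- The reflection as a self-diffeomorphism of the model manifold `ℝ³`. [folklore] -/
def reflectThird : 𝔼 3 ≃ₘ⟮𝓡 3, 𝓡 3⟯ 𝔼 3 := reflectThirdCLE.toDiffeomorph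

/-- The reflection diffeomorphism is the reflection isometry as a map (definitional). [folklore] -/
@[simp] theorem reflectThird_apply (p : 𝔼 3) : reflectThird p = reflectThirdCLE p := rfl

/-- The differential of the reflection is the reflection. [folklore] -/
theorem mfderiv_reflectThird (p : 𝔼 3) :
    mfderiv (𝓡 3) (𝓡 3) reflectThird p = (reflectThirdCLE : 𝔼 3 →L[ℝ] 𝔼 3) := by
  show mfderiv 𝓘(ℝ, 𝔼 3) 𝓘(ℝ, 𝔼 3) (reflectThirdCLE : 𝔼 3 → 𝔼 3) p = _
  rw [mfderiv_eq_fderiv, ContinuousLinearEquiv.fderiv]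

/-- The Jacobian determinant of the reflection diffeomorphism is `-1` at every point.
[folklore] -/
theorem det_mfderiv_reflectThird (p : 𝔼 3) :
    LinearMap.det (M := 𝔼 3) (mfderiv (𝓡 3) (𝓡 3) reflectThird p).toLinearMap = -1 := by
  have h := det_reflectThirdCLE
  rw [← mfderiv_reflectThird p] at h
  exact h

/-- **The reflection reverses the standard orientation of `ℝ³`** at every point: its Jacobian
determinant is `-1 < 0` (Hirsch, *Differential Topology* (1976), Ch. 4 §4, p. 105: "reflection
in a hyperplane always reverses orientation"). [cite: HirschDT1976, Ch. 4 §4, p. 105] -/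
theorem reflectThird_isOrientationReversing :
    reflectThird.IsOrientationReversing (SmoothOrientation.euclidean 3)
      (SmoothOrientation.euclidean 3) := by
  intro p
  have h1 : (-SmoothOrientation.euclidean 3) (reflectThird p) ≠ SmoothOrientation.euclidean 3 p := by
    rw [SmoothOrientation.neg_apply, SmoothOrientation.euclidean_apply,
      SmoothOrientation.euclidean_apply]
    exact (Module.Ray.ne_neg_self _).symm
  have h2 : ¬ 0 < LinearMap.det (M := 𝔼 3) (mfderiv (𝓡 3) (𝓡 3) reflectThird p).toLinearMap := by
    rw [det_mfderiv_reflectThird]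
    norm_num
  exact iff_of_false h1 h2

end Reflection

/-! ### §3 The mirror symmetry of an even regular sublevel set `{F ≤ c} ⊂ ℝ³` -/

section Mirror

namespace RegularSublevel

variable {F : 𝔼 3 → ℝ} {c : ℝ} (h : IsRegularLevel (𝓡 3) F c)
  (hF : ∀ p, F (reflectThird p) = F p)

/-- **The mirror symmetry `R₀` of `{F ≤ c}`** for `F` invariant under `z ↦ -z`: the
self-diffeomorphism induced by the reflection (`RegularSublevel.mapDiffeomorph`). [folklore] -/
def mirror : RegularSublevel h ≃ₘ⟮𝓡∂ 3, 𝓡∂ 3⟯ RegularSublevel h :=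
  mapDiffeomorph h h reflectThird hF

/-- **The mirror symmetry `r₀` of the level surface `{F = c} = ∂{F ≤ c}`**: the restriction of
`R₀` (`RegularSublevel.boundaryRestrictDiffeomorph`). [folklore] -/
def boundaryMirror :
    (𝓡∂ 3).boundary (RegularSublevel h) ≃ₘ⟮𝓡 2, 𝓡 2⟯ (𝓡∂ 3).boundary (RegularSublevel h) :=
  boundaryRestrictDiffeomorph h h reflectThird hF

/-- `R₀` is the reflection on points of `ℝ³`. [folklore] -/
theorem incl_mirror (p : RegularSublevel h) : incl h (mirror h hF p) = reflectThird (incl h p) :=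
  rfl

/-- `R₀` extends `r₀`: `R₀ ∘ incl = incl ∘ r₀` for the boundary datum of `{F ≤ c}`
(`RegularSublevel.mapDiffeomorph_comp_incl`). [folklore] -/
theorem mirror_incl (z : (𝓡∂ 3).boundary (RegularSublevel h)) :
    mirror h hF ((boundaryData h).incl z) = (boundaryData h).incl (boundaryMirror h hF z) := rfl

/-- **`R₀` reverses the orientation of `{F ≤ c}` induced from `ℝ³`**
(`RegularSublevel.orientation`): `incl ∘ R₀ = R ∘ incl` with `incl` orientation preserving
(`RegularSublevel.isOrientationPreserving_incl`) and the ambient reflection `R` orientation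
reversing (`reflectThird_isOrientationReversing`); cancel `incl`
(`IsOrientationPreserving.of_comp_left`). Hirsch (1976), Ch. 4 §4.
[cite: HirschDT1976, Ch. 4 §4, pp. 101–105] -/
theorem mirror_isOrientationReversing :
    (mirror h hF).IsOrientationReversing (orientation h (SmoothOrientation.euclidean 3))
      (orientation h (SmoothOrientation.euclidean 3)) := by
  have hn : (∞ : WithTop ℕ∞) ≠ 0 := by simp
  set o := orientation h (SmoothOrientation.euclidean 3) with ho
  have hincl : IsOrientationPreserving o (SmoothOrientation.euclidean 3) (incl h) :=
    isOrientationPreserving_incl h (SmoothOrientation.euclidean 3)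
  have hR : IsOrientationPreserving (SmoothOrientation.euclidean 3)
      (-SmoothOrientation.euclidean 3) reflectThird := reflectThird_isOrientationReversing
  have hdetR : ∀ y : 𝔼 3, LinearMap.det (M := 𝔼 3)
      (mfderiv (𝓡 3) (𝓡 3) reflectThird y).toLinearMap ≠ 0 := fun y => by
    rw [det_mfderiv_reflectThird]; norm_num
  -- `R ∘ incl` preserves `(o, -std)`
  have hcomp : IsOrientationPreserving o (-SmoothOrientation.euclidean 3)
      (reflectThird ∘ incl h) :=
    IsOrientationPreserving.comp_holds hR hincl (reflectThird.mdifferentiable hn)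
      ((contMDiff_incl h).mdifferentiable hn) hdetR (det_mfderiv_incl_ne_zero h)
  -- `R ∘ incl = incl ∘ R₀`
  have heq : (reflectThird ∘ incl h : RegularSublevel h → 𝔼 3) = incl h ∘ mirror h hF := rfl
  rw [heq] at hcomp
  have hincl' : IsOrientationPreserving (-o) (-SmoothOrientation.euclidean 3) (incl h) := by
    rw [isOrientationPreserving_neg_neg_iff]; exact hincl
  exact IsOrientationPreserving.of_comp_left hcomp hincl'
    ((contMDiff_incl h).mdifferentiable hn) ((mirror h hF).mdifferentiable hn)
    (det_mfderiv_incl_ne_zero h) ((mirror h hF).det_mfderiv_ne_zero hn)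

/-- **`r₀` reverses the boundary orientation of the level surface `{F = c}`**
(`Diffeomorph.isOrientationReversing_boundaryMap`: the boundary restriction of an
orientation-reversing diffeomorphism is orientation reversing for the boundary orientations,
`BoundaryOrientation.lean`). Hirsch (1976), Ch. 4 §4, p. 103.
[cite: HirschDT1976, Ch. 4 §4, p. 103] -/
theorem boundaryMirror_isOrientationReversing :
    (boundaryMirror h hF).IsOrientationReversing
      (orientation h (SmoothOrientation.euclidean 3)).boundary
      (orientation h (SmoothOrientation.euclidean 3)).boundary :=
  Diffeomorph.isOrientationReversing_boundaryMap (mirror h hF) (ρ := boundaryMirror h hF)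
    (fun _ => rfl) (mirror_isOrientationReversing h hF)

include hF in
/-- **SYMM at `g` from one even model**: if the regular sublevel set `{F ≤ c} ⊂ ℝ³` of a
function `F` invariant under `(x, y, z) ↦ (x, y, -z)` is a genus-`g` handlebody, then the
clause `g` of `Literature.Topology.FourManifolds.exists_isHandlebody_isOrientationReversing` holds (universe `0`), witnessed by
`{F ≤ c}`, its boundary datum, the boundary orientation induced from `ℝ³`, and the mirror
symmetries `R₀`, `r₀`. Juhász (2023), §3.5, p. 97 ("every handlebody admits an
orientation-reversing symmetry": the mirror image). [cite: Juhasz2023, §3.5 (p. 97)] -/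
theorem exists_isHandlebody_isOrientationReversing_of_even {g : ℕ}
    (hH : IsHandlebody g (RegularSublevel h)) :
    ∃ (H₀ : Type) (_ : TopologicalSpace H₀) (_ : T2Space H₀) (_ : SecondCountableTopology H₀)
      (_ : ChartedSpace (EuclideanHalfSpace 3) H₀) (_ : IsManifold (𝓡∂ 3) ∞ H₀)
      (b₀ : BoundaryData (𝓡∂ 3) H₀ (𝓡 2)) (o₀ : SmoothOrientation (𝓡 2) b₀.carrier)
      (R₀ : H₀ ≃ₘ⟮𝓡∂ 3, 𝓡∂ 3⟯ H₀) (r₀ : b₀.carrier ≃ₘ⟮𝓡 2, 𝓡 2⟯ b₀.carrier),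
      IsHandlebody g H₀ ∧ (∀ z, R₀ (b₀.incl z) = b₀.incl (r₀ z)) ∧
        r₀.IsOrientationReversing o₀ o₀ :=
  ⟨RegularSublevel h, inferInstance, inferInstance, inferInstance, inferInstance, inferInstance,
    boundaryData h, (orientation h (SmoothOrientation.euclidean 3)).boundary, mirror h hF,
    boundaryMirror h hF, hH, mirror_incl h hF, boundaryMirror_isOrientationReversing h hF⟩

end RegularSublevel

/-- **SYMM from a family of even models.** If for every `g` some function `F : ℝ³ → ℝ`
invariant under `z ↦ -z` has a regular level `c` with `{F ≤ c}` a genus-`g` handlebody, then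
`Literature.Topology.FourManifolds.exists_isHandlebody_isOrientationReversing` holds (universe `0`). Juhász (2023), §3.5,
p. 97. [cite: Juhasz2023, §3.5 (p. 97)] -/
theorem exists_isHandlebody_isOrientationReversing_of_even_models
    (hmod : ∀ g : ℕ, ∃ (F : 𝔼 3 → ℝ) (c : ℝ) (h : IsRegularLevel (𝓡 3) F c),
      (∀ p, F (reflectThird p) = F p) ∧ IsHandlebody g (RegularSublevel h)) :
    exists_isHandlebody_isOrientationReversing.{0} := by
  intro g
  obtain ⟨F, c, h, hF, hH⟩ := hmod g
  exact RegularSublevel.exists_isHandlebody_isOrientationReversing_of_even h hF hH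

end Mirror

/-! ### §4 Genus one: the solid torus -/

namespace SolidTorusModel

/-- The Morse function `f(x, y, z) = (x² + y²)² - 392 (x² + y²) + z² - 3840 x` of
`SolidTorusHandlebody.lean` is invariant under `z ↦ -z`. [folklore] -/
theorem fn_reflectThird (p : 𝔼 3) : fn (reflectThird p) = fn p := by
  simp only [fn, reflectThird_apply, reflectThirdCLE_apply_coord]
  simp only [Fin.isValue, show (0 : Fin 3) ≠ 2 by decide, show (1 : Fin 3) ≠ 2 by decide,
    ↓reduceIte]
  ring

end SolidTorusModel

/-- **SYMM for `g = 1`**: the solid torus `V₁ = {f ≤ 10000} ⊂ ℝ³`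
(`Literature.Topology.FourManifolds.SolidTorusModel.isHandlebody_one_solidTorus`, a genus-`1` handlebody; Schultens (2014),
Example 6.1.9) with its mirror symmetry `z ↦ -z` witnesses the clause `g = 1` of
`Literature.Topology.FourManifolds.exists_isHandlebody_isOrientationReversing` (universe `0`). Juhász (2023), §3.5, p. 97.
[cite: Juhasz2023, §3.5 (p. 97)] -/
theorem exists_isHandlebody_isOrientationReversing_one :
    ∃ (H₀ : Type) (_ : TopologicalSpace H₀) (_ : T2Space H₀) (_ : SecondCountableTopology H₀)
      (_ : ChartedSpace (EuclideanHalfSpace 3) H₀) (_ : IsManifold (𝓡∂ 3) ∞ H₀)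
      (b₀ : BoundaryData (𝓡∂ 3) H₀ (𝓡 2)) (o₀ : SmoothOrientation (𝓡 2) b₀.carrier)
      (R₀ : H₀ ≃ₘ⟮𝓡∂ 3, 𝓡∂ 3⟯ H₀) (r₀ : b₀.carrier ≃ₘ⟮𝓡 2, 𝓡 2⟯ b₀.carrier),
      IsHandlebody 1 H₀ ∧ (∀ z, R₀ (b₀.incl z) = b₀.incl (r₀ z)) ∧
        r₀.IsOrientationReversing o₀ o₀ :=
  RegularSublevel.exists_isHandlebody_isOrientationReversing_of_even
    SolidTorusModel.isRegularLevel_fn SolidTorusModel.fn_reflectThird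
    SolidTorusModel.isHandlebody_one_solidTorus

/-! ### §5 F2b₂ in genus `≤ 1` from the classification alone -/

/-- **F2b₂ for `g ≤ 1` from UNIQ** (universe `0`): every handlebody of genus `0` or `1` admits a
self-diffeomorphism restricting to an orientation-reversing diffeomorphism of its boundary,
granted the classification of handlebodies `Literature.Topology.FourManifolds.IsHandlebody.nonempty_diffeomorph` — transport
of the symmetry of the model (`𝔻³`: `Literature.Topology.FourManifolds.exists_isHandlebody_isOrientationReversing_zero`;
`V₁`: `exists_isHandlebody_isOrientationReversing_one`) along a diffeomorphism, by the argument
of `Literature.Topology.FourManifolds.IsHandlebody.exists_diffeomorph_isOrientationReversing_boundary_of_nonempty_diffeomorph`.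
Juhász (2023), §3.5, p. 97. [cite: Juhasz2023, §3.5 (p. 97)] -/
theorem IsHandlebody.exists_diffeomorph_isOrientationReversing_boundary_of_le_one
    (hU : IsHandlebody.nonempty_diffeomorph.{0}) (g : ℕ) (hg : g ≤ 1)
    (H : Type) [TopologicalSpace H] [T2Space H] [SecondCountableTopology H]
    [ChartedSpace (EuclideanHalfSpace 3) H] [IsManifold (𝓡∂ 3) ∞ H]
    (hH : IsHandlebody g H) (b : BoundaryData (𝓡∂ 3) H (𝓡 2)) :
    ∃ (o : SmoothOrientation (𝓡 2) b.carrier) (R : H ≃ₘ⟮𝓡∂ 3, 𝓡∂ 3⟯ H)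
      (r : b.carrier ≃ₘ⟮𝓡 2, 𝓡 2⟯ b.carrier),
      (∀ z, R (b.incl z) = b.incl (r z)) ∧ r.IsOrientationReversing o o := by
  -- run the transport argument with the model of genus `g`
  have hmodel : ∃ (H₀ : Type) (_ : TopologicalSpace H₀) (_ : T2Space H₀)
      (_ : SecondCountableTopology H₀) (_ : ChartedSpace (EuclideanHalfSpace 3) H₀)
      (_ : IsManifold (𝓡∂ 3) ∞ H₀) (b₀ : BoundaryData (𝓡∂ 3) H₀ (𝓡 2))
      (o₀ : SmoothOrientation (𝓡 2) b₀.carrier) (R₀ : H₀ ≃ₘ⟮𝓡∂ 3, 𝓡∂ 3⟯ H₀)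
      (r₀ : b₀.carrier ≃ₘ⟮𝓡 2, 𝓡 2⟯ b₀.carrier),
      IsHandlebody g H₀ ∧ (∀ z, R₀ (b₀.incl z) = b₀.incl (r₀ z)) ∧
        r₀.IsOrientationReversing o₀ o₀ := by
    rcases Nat.le_one_iff_eq_zero_or_eq_one.mp hg with rfl | rfl
    · exact exists_isHandlebody_isOrientationReversing_zero
    · exact exists_isHandlebody_isOrientationReversing_one
  obtain ⟨H₀, _, _, _, _, _, b₀, o₀, R₀, r₀, hH₀, hRr₀, hrev₀⟩ := hmodel
  obtain ⟨φ⟩ := hU g H H₀ hH hH₀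
  set ψ := b.restrictDiffeomorph b₀ φ with hψ
  have hn : (∞ : WithTop ℕ∞) ≠ 0 := by simp
  refine ⟨o₀.comap ψ hn, φ.trans (R₀.trans φ.symm), (ψ.trans r₀).trans ψ.symm, ?_, ?_⟩
  · intro z
    have h1 : φ (b.incl z) = b₀.incl (ψ z) := (BoundaryData.incl_restrictDiffeomorph φ z).symm
    have h2 : ∀ w, φ.symm (b₀.incl w) = b.incl (ψ.symm w) := fun w => by
      have h3 : φ (b.incl (ψ.symm w)) = b₀.incl w := by
        rw [← BoundaryData.incl_restrictDiffeomorph (b₁ := b) (b₂ := b₀) φ (ψ.symm w), ← hψ,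
          Diffeomorph.apply_symm_apply]
      rw [← h3, Diffeomorph.symm_apply_apply]
    simp only [Diffeomorph.coe_trans, comp_apply]
    rw [h1, hRr₀, h2]
  · have hψo : ψ.IsOrientationPreserving (o₀.comap ψ hn) o₀ :=
      SmoothOrientation.isOrientationPreserving_comap o₀ ψ hn
    have hψs : ψ.symm.IsOrientationPreserving o₀ (o₀.comap ψ hn) :=
      Diffeomorph.IsOrientationPreserving.symm_holds hψo hn
    have hψs' : ψ.symm.IsOrientationPreserving (-o₀) (-(o₀.comap ψ hn)) := by
      rw [Diffeomorph.IsOrientationPreserving, isOrientationPreserving_neg_neg_iff]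
      exact hψs
    have hr₀ : r₀.IsOrientationPreserving o₀ (-o₀) := hrev₀
    have h12 : (ψ.trans r₀).IsOrientationPreserving (o₀.comap ψ hn) (-o₀) :=
      Diffeomorph.IsOrientationPreserving.trans_holds hψo hr₀ hn
    exact Diffeomorph.IsOrientationPreserving.trans_holds h12 hψs' hn

end Literature.Topology.FourManifolds
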